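import Summits.QuantumFields.BalabanUV.Beta.FP.StepKernelWardDataRecord
import Summits.QuantumFields.BalabanUV.Beta.CombOneShotJetsTabs

/-!
# `BalabanUV.Beta.FP.StepRecursionFeedTabs` — road «FP» for binder row D1, ROUTE T, OWNER #31: **THE (F1) END AT THE (III′) LITERAL FOR THE ONE-SHOT
# COMPOSITE JET DATA `JcOfTabs` (an2's R-D1-g42-4 ∕ R-D1-g43-2 «one `Jc` for both roads = the composite-contour literal») — M‴'s `htel` from an4's
# `StepRecursion` in ONE hypothesis, resp. from the road's rows (L1)(L2′), with (L3′) AND (L4′) DISCHARGED**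

WHY (W-an2-g43-9, journal l.47638: «#31 — yours, GO»).  The `Jc` of record for ROOT M‴'s `htel : D1Tel Lc (JsB12CombShSym hLc N (symTablesAn1S2 3 Lc cΛ) cΛ cB) Jc`
is the composite-contour literal, named by the row OWNER as `CombOneShotJetsTabs.JcOfTabs hLc N tabs cΛ cB m := JsB12CombShSym (Lc := Lc^m) hLc.pow N (tabs m)
(cΛ m) (cB m) 0` over a scale-indexed table record `tabs` (`JcOf` = its an1-instance by `rfl`; `tabsComp`'s members are DEFINED by the recursion — R-D1-g43-2).
an2's `TshotOf_JcOfTabs_one (h1 : HEq (tabs 1) tabs₁)` is an4's base identity `hbase` at that literal; OWNER #30d `FP/StepKernelWardDataRecord` §2 makes the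
(T0)(T1) rows of the step kernels theorems at the locks.  THIS FILE composes the two with an4's node theorem ∕ #28's socket: for ANY `tabs` whose depth-1
member IS an1's record at the level-1 locks (`h1`), M‴'s `htel` at `Jc := JcOfTabs …` follows from `StepRecursion Lc (TbalOf …) (TshotOf Lc (JcOfTabs …))
(wStep Lc)` ALONE (§1), resp. from (L1) `hlaw` + (L2′) `hN hF hG` ALONE (§2) — no `hbase`, no `hT0 hT1` displayed.  [folklore] composition BY NAME (an4's
`HessianTelescopingKKT.d1Tel_of_stepRecursion_wStep` — the node author's own junction J1, journal l.47555 —, #28 `StepRecursionFeed.d1Tel_of_kernel_laws_wStep`,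
#30d `stepT0_∕stepT1_JsB12CombShSym_an1S2_pinned`, an2's `TshotOf_JcOfTabs_one`); no `def`, no `def … : Prop`, nothing cited, 0 sorry.

WHAT STAYS DISPLAYED: `hrec` (§1) resp. (L1)(L2′) (§2) — the road's (T-ID) assembly —, the anchor `h1`, and M‴'s own scalars `Odd Lc`, `2 ≤ Lc`, `2 ≤ N`,
`hΛ : cΛ 1 · Lc⁴ = 2`, `hcB : cB 1 = −Lc¹²∕4` (the level-1 locks; deeper locks `cΛ m, cB m` are FREE — Q-an2-g42-2 «FREE as staged», d1-p2 ∕ d1-p3 concordant).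
NOT HERE: `tabsComp` itself (the row's), any claim that a `tabs` IS Bałaban's composite record ((C1)), any estimate.

HONEST DEPENDENCY (page 1, mandatory): continuum YM on T⁴ ⇐ BetaPertH ∧ nine spine estimates (0/9 proved); BetaPertH ⇐ (D1) ∧ (D4) ∧ CAP+tail;
G-an2-4 gates asym, D1 and NE2/3/4.  HONEST FRAMING (cell contract, verbatim): «discharging `BetaPertH` makes Bałaban's UV stability UNCONDITIONAL —
a real constructive-QFT result; it is NOT the continuum limit and NOT the Clay problem.»  ABSOLUTE RULE (cell charter, verbatim): «No internally-minted
statement may enter as a cited fact. Every hypothesis is either kernel-proved in this package or a verbatim quotation of a PUBLISHED theorem with page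
reference. The manuscript(s) under audit are NOT citable for their own disputed steps — they are the thing under adjudication; programme-internal
(2001/route/tribunal) claims are never citable.»  Nothing of Bałaban's asserted; 0 estimates; 0∕4 row-D1 binders (hW, hR, D1Tel, D1Rep — `D1Tel` is CONCLUDED
only from the displayed `hrec` ∕ rows); ROOT M‴ p325680 untouched; NOT (T-ID), NOT SDF, NOT D1, NOT BetaPertH, NOT continuum, NOT Clay.
Road «FP» OWNER, b2b-balaban-beta-d1-p3 gen 23, 2026-08-22.  No existing file touched.
-/

noncomputable section

namespace Summit.QuantumFields.BalabanUV.Beta.FP.StepRecursionFeedTabs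

open Literature.MathematicalPhysics.QuantumFieldTheory.Balaban1983to89
open Literature.MathematicalPhysics.QuantumFieldTheory.Balaban1983to89.Beta
open DressedMomentNormalisation (EKer dressedEntry)
open OneStepKernelFamily (TbalOf TshotOf D1Tel)
open HessianTelescopingKKT (StepRecursion wStep d1Tel_of_stepRecursion_wStep)
open Summit.QuantumFields.BalabanUV.Beta.SymmetrisedStepJets (SymTables)
open Summit.QuantumFields.BalabanUV.Beta.SymSecondOrderTablesAn1 (symTablesAn1S2)
open Summit.QuantumFields.BalabanUV.Beta.CombChartJointEnd (JsB12CombShSym)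
open Summit.QuantumFields.BalabanUV.Beta.CombOneShotJetsTabs (JcOfTabs TshotOf_JcOfTabs_one)
open Summit.QuantumFields.BalabanUV.Beta.FP.StepRecursionFeed (d1Tel_of_kernel_laws_wStep)
open Summit.QuantumFields.BalabanUV.Beta.FP.StepKernelWardDataRecord (stepT0_JsB12CombShSym_an1S2_pinned stepT1_JsB12CombShSym_an1S2_pinned)

variable {Lc : ℕ} [NeZero Lc]

/-! ## §1 From an4's `StepRecursion` alone -/

/-- [folklore] **`D1Tel` AT THE (III′) LITERAL FOR `JcOfTabs`, FROM an4's `StepRecursion` IN ONE HYPOTHESIS.**  For any scale-indexed record `tabs` whose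
depth-1 member is an1's record at the level-1 lock (`h1`, an2's `HEq` currency across `Lc¹ = Lc`): `StepRecursion Lc (TbalOf Lc (JsB12CombShSym hLc N
(symTablesAn1S2 3 Lc (cΛ 1)) (cΛ 1) (cB 1))) (TshotOf Lc (JcOfTabs hLc N tabs cΛ cB)) (wStep Lc)` ⟹ M‴'s `htel` at `Jc := JcOfTabs hLc N tabs cΛ cB` — an4's
`d1Tel_of_stepRecursion_wStep` with (T0)(T1) from #30d and `hbase := TshotOf_JcOfTabs_one`. -/
theorem d1Tel_JcOfTabs_of_stepRecursion_wStep_pinned (hLc : Odd Lc) (hL2 : 2 ≤ Lc) {N : ℕ} (hN : 2 ≤ N) (cΛ cB : ℕ → ℝ)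
    (hΛ : cΛ 1 * (Lc : ℝ) ^ 4 = 2) (hcB : cB 1 = -((Lc : ℝ) ^ 12 / 4)) (tabs : ∀ m : ℕ, SymTables 3 (Lc ^ m))
    (h1 : HEq (tabs 1) (symTablesAn1S2 3 Lc (cΛ 1)))
    (hrec : StepRecursion Lc (TbalOf Lc (JsB12CombShSym hLc N (symTablesAn1S2 3 Lc (cΛ 1)) (cΛ 1) (cB 1))) (TshotOf Lc (JcOfTabs hLc N tabs cΛ cB))
      (wStep Lc)) :
    D1Tel Lc (JsB12CombShSym hLc N (symTablesAn1S2 3 Lc (cΛ 1)) (cΛ 1) (cB 1)) (JcOfTabs hLc N tabs cΛ cB) :=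
  d1Tel_of_stepRecursion_wStep _ _ (stepT0_JsB12CombShSym_an1S2_pinned hLc hL2 hN (cΛ 1) (cB 1) hΛ hcB)
    (stepT1_JsB12CombShSym_an1S2_pinned hLc hL2 hN (cΛ 1) (cB 1) hΛ hcB) (TshotOf_JcOfTabs_one hLc N tabs cΛ cB (symTablesAn1S2 3 Lc (cΛ 1)) h1) hrec

/-! ## §2 From the road's rows (L1)(L2′) alone -/

/-- [folklore] **`D1Tel` AT THE (III′) LITERAL FOR `JcOfTabs`, FROM THE ROAD's KERNEL ROWS (L1)(L2′) ALONE** — #28 §3 `d1Tel_of_kernel_laws_wStep` with (L3′)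
`hbase := TshotOf_JcOfTabs_one … h1` and (L4′) `hT0 hT1 :=` #30d §2.  Displayed: (L1) `hlaw` (the de-periodised door per `j ≥ 1`), (L2′) `hN hF hG` at the
canonical weight, the anchor `h1`, M‴'s level-1 scalars. -/
theorem d1Tel_JcOfTabs_of_kernel_laws_wStep_pinned (hLc : Odd Lc) (hL2 : 2 ≤ Lc) {N : ℕ} (hN : 2 ≤ N) (cΛ cB : ℕ → ℝ)
    (hΛ : cΛ 1 * (Lc : ℝ) ^ 4 = 2) (hcB : cB 1 = -((Lc : ℝ) ^ 12 / 4)) (tabs : ∀ m : ℕ, SymTables 3 (Lc ^ m))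
    (h1 : HEq (tabs 1) (symTablesAn1S2 3 Lc (cΛ 1))) (𝒦N 𝒦F 𝒦G : ℕ → EKer 4)
    (hlaw : ∀ j : ℕ, 1 ≤ j → ∀ (a b : Fin 4) (z : Fin 4 → ℤ), 𝒦N j a b z = 𝒦F j a b z + 𝒦G j a b z)
    (hN' : ∀ j : ℕ, 1 ≤ j → ∀ (a b : Fin 4) (z : Fin 4 → ℤ), 𝒦N j a b z = TshotOf Lc (JcOfTabs hLc N tabs cΛ cB) (j + 1) a b z)
    (hF : ∀ j : ℕ, 1 ≤ j → ∀ (a b : Fin 4) (z : Fin 4 → ℤ),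
      𝒦F j a b z = (Lc : ℝ) ^ 8 * dressedEntry (wStep Lc j) (TshotOf Lc (JcOfTabs hLc N tabs cΛ cB) j) ((Lc : ℤ) • z) a b)
    (hG : ∀ j : ℕ, 1 ≤ j → ∀ (a b : Fin 4) (z : Fin 4 → ℤ),
      𝒦G j a b z = TbalOf Lc (JsB12CombShSym hLc N (symTablesAn1S2 3 Lc (cΛ 1)) (cΛ 1) (cB 1)) j a b z) :
    D1Tel Lc (JsB12CombShSym hLc N (symTablesAn1S2 3 Lc (cΛ 1)) (cΛ 1) (cB 1)) (JcOfTabs hLc N tabs cΛ cB) :=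
  d1Tel_of_kernel_laws_wStep _ _ 𝒦N 𝒦F 𝒦G hlaw hN' hF hG (stepT0_JsB12CombShSym_an1S2_pinned hLc hL2 hN (cΛ 1) (cB 1) hΛ hcB)
    (stepT1_JsB12CombShSym_an1S2_pinned hLc hL2 hN (cΛ 1) (cB 1) hΛ hcB) (TshotOf_JcOfTabs_one hLc N tabs cΛ cB (symTablesAn1S2 3 Lc (cΛ 1)) h1)

end Summit.QuantumFields.BalabanUV.Beta.FP.StepRecursionFeedTabs

end
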